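import Summits.AtomisticToContinuum.HydrodynamicLimit.Theorems.CollisionIsometryCLTAdaptedWeightCLTBHFewCollisionsCount
import Summits.AtomisticToContinuum.HydrodynamicLimit.Theses.InformationPercolationEngine

/-!
# `stub_fewCollisions` (S0 of the line `block-h-dissipation-closure`, crux `AdaptedWeightCLT`,
# stmt-AtomisticToContinuum-14868) REDUCED to the open support item `CollisionMomentBound` (stmt-AtomisticToContinuum-15144)

Support file (`--supports stmt-AtomisticToContinuum-14868`, helper anchor `bhFewCollisions_reduction_anchor`) of the stub
worker of `stub_fewCollisions`. It identifies the EXISTING named statement the stub hinges on. The route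
`InformationPercolationEngine` files, as its open support item stmt-AtomisticToContinuum-15144
(`Theses.InformationPercolationEngine.CollisionMomentBound`, "second velocity moments of the empirical collision
functional are tight"), the statement that for continuous positive profiles there is `σ₀ > 0` such that for
`0 < σ < σ₀`, every flow family, every `τ > 0` and `δ > 0` there are `K_b, N₀` with

  `P_N{ K_b < (ε_N/(N+1)) Σ_{collision times s ∈ [0,τ]} Σ_{ordered contact pairs (i,j)} (1 + ‖vᵢ(s)‖² + ‖vⱼ(s)‖²) } ≤ δ`, `N ≥ N₀`,

under the local Gibbs law — TIGHTNESS of the energy-weighted collision count at its kinetic scale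
`(N+1)/ε_N = σ⁻¹ (N+1)^{4/3}` along the NON-EQUILIBRIUM flow (no `TailsOn` hypothesis; `∃ σ₀`). MAIN RESULT
(`fewCollisionsOn_of_collisionMomentBound`): it implies the line's S0 in the form
`∀ nice profiles ∃ σ₀ > 0 ∀ σ ∈ (0, σ₀) ∀ Φ ∀ t > 0, FewCollisionsOn σ a₀ θ₀ u₀ Φ t` — on good orbits (conull) the item's
functional dominates `(ε_N/(N+1)) · collCount σ N (Φ N) t` (`collCount_le_markSum`: drop the `i < j` filter, enlarge
`(0,t]` to `[0,t]`), and `(ε_N/(N+1)) (N+1)^{4/3+p} = σ (N+1)^p → ∞` exceeds every `K_b` (`scale_eq`). So the registered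
S0 (which asks ALL `σ < 1/2` and offers `TailsOn`) is, up to its `σ`-range, a COROLLARY of stmt-15144; conversely nothing
weaker than a kinetic-scale bound on the energy-weighted count along the true flow is known to give it (the item's own
"why it might fail": a collision functional weights fast pairs by their rate, third moments along the TRUE flow; the
entropy route from the invariant law is barred, cf. the refuted stmt-13733). No definitions are introduced.
-/

namespace Summit.AtomisticToContinuum.HydrodynamicLimit.Theorems.BlockHDissipation

open scoped BigOperators Topology Classical MeasureTheory ENNReal InnerProductSpace
open Filter Set MeasureTheory
open Literature.Analysis.FluidPDE
open Summit.AtomisticToContinuum.HydrodynamicLimit.Theorems.ContactSourceDuhamel (T3 V3 Cfg Vel Flow Flows)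
open Summit.AtomisticToContinuum.HydrodynamicLimit.Theorems.ContactSourceDuhamel.TimeLocal
open Literature.MathematicalPhysics.KineticTheory (hsDiameter hsDiameter_le hsDiameter_pos localGibbsLaw
  localGibbsLaw_absolutelyContinuous ae_mem_good_localGibbsLaw)
open Summit.AtomisticToContinuum.HydrodynamicLimit.Theses.InformationPercolationEngine (CollisionMomentBound)

noncomputable section

namespace FewCollisions

variable {σ : ℝ} {N : ℕ}

/-- **`collCount` is dominated by the route functional of stmt-15144** on good orbits: the real collision sum over
`[0, t]` of the full pair energy weight over all ordered contact pairs, inline form. -/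
theorem collCount_le_markSum (Φ : Flow σ N) {z : Cfg N} (hz : z ∈ Φ.good) (t : ℝ) :
    collCount σ N Φ t z ≤
      ∑ᶠ s ∈ collisionTimes (Torus.geometry (Fin 3)) (hsDiameter σ N) (fun r => Φ.flow r z) ∩ Icc 0 t,
        ∑ i : Fin (N + 1), ∑ j : Fin (N + 1),
          (if i ≠ j ∧ ‖(Torus.geometry (Fin 3)).sepVec (Φ.flow s z i).1 (Φ.flow s z j).1‖ = hsDiameter σ N
            then 1 + ‖(Φ.flow s z i).2‖ ^ 2 + ‖(Φ.flow s z j).2‖ ^ 2 else 0) := by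
  have hfinC : (collisionTimes (Torus.geometry (Fin 3)) (hsDiameter σ N) (fun r => Φ.flow r z) ∩ Icc 0 t).Finite :=
    Φ.finite_collisionTimes_inter hz Subset.rfl
  calc collCount σ N Φ t z
      ≤ collisionPairSum (Torus.geometry (Fin 3)) (hsDiameter σ N) (fun r => Φ.flow r z) (Icc 0 t)
          (fun s i j => 1 + ‖(Φ.flow s z i).2‖ ^ 2 + ‖(Φ.flow s z j).2‖ ^ 2) := by
        rw [collCount_eq]
        exact (collisionPairSum_mono_set Ioc_subset_Icc_self hfinC fun r i j => collMark_nonneg (Φ.flow r z) i j).trans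
          (collisionPairSum_mono hfinC fun s _ p _ => collMark_le (Φ.flow s z) p.1 p.2)
    _ = _ := collisionPairSum_eq_finsum_ite (fun r => (Φ.isTrajectory z hz).mem r) (Icc 0 t) _

/-- The scale identity `(ε_N/(N+1)) (N+1)^{4/3+p} = σ (N+1)^p`. -/
theorem scale_eq (σ p : ℝ) (N : ℕ) :
    hsDiameter σ N / ((N : ℝ) + 1) * ((N + 1 : ℕ) : ℝ) ^ ((4 : ℝ) / 3 + p) = σ * ((N + 1 : ℕ) : ℝ) ^ p := by
  have hx : (0 : ℝ) < ((N + 1 : ℕ) : ℝ) := by positivity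
  have hcast : ((N : ℝ) + 1) = ((N + 1 : ℕ) : ℝ) := by push_cast; ring
  have h1 : ((N + 1 : ℕ) : ℝ) ^ (-(1 / 3 : ℝ)) * ((N + 1 : ℕ) : ℝ) ^ ((4 : ℝ) / 3 + p) =
      ((N + 1 : ℕ) : ℝ) * ((N + 1 : ℕ) : ℝ) ^ p := by
    rw [← Real.rpow_add hx]
    have : -(1 / 3 : ℝ) + (4 / 3 + p) = 1 + p := by ring
    rw [this, Real.rpow_add hx, Real.rpow_one]
  rw [hcast]
  calc hsDiameter σ N / ((N + 1 : ℕ) : ℝ) * ((N + 1 : ℕ) : ℝ) ^ ((4 : ℝ) / 3 + p)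
      = σ * (((N + 1 : ℕ) : ℝ) ^ (-(1 / 3 : ℝ)) * ((N + 1 : ℕ) : ℝ) ^ ((4 : ℝ) / 3 + p)) / ((N + 1 : ℕ) : ℝ) := by
        unfold hsDiameter; ring
    _ = σ * (((N + 1 : ℕ) : ℝ) * ((N + 1 : ℕ) : ℝ) ^ p) / ((N + 1 : ℕ) : ℝ) := by rw [h1]
    _ = σ * ((N + 1 : ℕ) : ℝ) ^ p := by field_simp

/-- `σ (N+1)^p → ∞` for `σ, p > 0`. -/
theorem tendsto_const_mul_natSucc_rpow {σ p : ℝ} (hσ : 0 < σ) (hp : 0 < p) :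
    Tendsto (fun N : ℕ => σ * ((N + 1 : ℕ) : ℝ) ^ p) atTop atTop := by
  have hcast : Tendsto (fun N : ℕ => ((N + 1 : ℕ) : ℝ)) atTop atTop :=
    tendsto_natCast_atTop_atTop.comp (tendsto_add_atTop_nat 1)
  exact ((tendsto_rpow_atTop hp).comp hcast).const_mul_atTop hσ

/-- **S0 FROM stmt-15144.** `CollisionMomentBound` (open support item of route `InformationPercolationEngine`) implies,
for nice profiles, `∃ σ₀ > 0` such that for every `0 < σ < σ₀`, every flow family and every `t > 0`,
`FewCollisionsOn σ a₀ θ₀ u₀ Φ t` (no `TailsOn` needed). -/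
theorem fewCollisionsOn_of_collisionMomentBound (hCMB : CollisionMomentBound) (a₀ θ₀ : T3 → ℝ) (u₀ : T3 → V3)
    (hnice : NiceProfiles a₀ θ₀ u₀) :
    ∃ σ₀ : ℝ, 0 < σ₀ ∧ ∀ σ : ℝ, 0 < σ → σ < σ₀ →
      ∀ (Φ : Flows σ) (t : ℝ), 0 < t → FewCollisionsOn σ a₀ θ₀ u₀ Φ t := by
  obtain ⟨ha, hθ, hu, ha0, hθ0⟩ := hnice
  obtain ⟨σ₀, hσ₀, H⟩ := hCMB a₀ θ₀ u₀ ha hθ hu ha0 hθ0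
  refine ⟨σ₀, hσ₀, fun σ hσ hσlt Φ t ht p hp => ?_⟩
  rw [tendsto_order]
  refine ⟨fun a ha => (ENNReal.not_lt_zero ha).elim, fun a' ha' => ?_⟩
  obtain ⟨r, -, hr0, hra⟩ := ENNReal.lt_iff_exists_real_btwn.1 ha'
  have hr : 0 < r := ENNReal.ofReal_pos.1 hr0
  obtain ⟨Kb, N₀, hK⟩ := H σ hσ hσlt Φ t ht r hr
  have hev : ∀ᶠ N : ℕ in atTop, Kb < σ * ((N + 1 : ℕ) : ℝ) ^ p :=
    (tendsto_const_mul_natSucc_rpow hσ hp).eventually_gt_atTop Kb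
  filter_upwards [eventually_ge_atTop N₀, hev] with N hN hNK
  refine lt_of_le_of_lt ((measure_mono_ae ?_).trans (hK N hN)) hra
  filter_upwards [ae_mem_good_localGibbsLaw σ a₀ u₀ θ₀ N (Φ N)] with z hz hzE
  have hzE' : ((N + 1 : ℕ) : ℝ) ^ ((4 : ℝ) / 3 + p) < collCount σ N (Φ N) t z := hzE
  show Kb < _
  have hεpos : 0 < hsDiameter σ N / ((N : ℝ) + 1) := div_pos (hsDiameter_pos hσ N) (by positivity)
  calc Kb < σ * ((N + 1 : ℕ) : ℝ) ^ p := hNK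
    _ = hsDiameter σ N / ((N : ℝ) + 1) * ((N + 1 : ℕ) : ℝ) ^ ((4 : ℝ) / 3 + p) := (scale_eq σ p N).symm
    _ ≤ hsDiameter σ N / ((N : ℝ) + 1) * collCount σ N (Φ N) t z :=
        mul_le_mul_of_nonneg_left hzE'.le hεpos.le
    _ ≤ _ := mul_le_mul_of_nonneg_left (collCount_le_markSum (Φ N) hz t) hεpos.le

/-- Registration anchor of this helper file (`--supports stmt-AtomisticToContinuum-14868`, reduction of
`stub_fewCollisions`): the open support item `CollisionMomentBound` (stmt-AtomisticToContinuum-15144) gives S0 for all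
nice profiles, all `σ` below some `σ₀ > 0`, every flow family and every horizon. -/
theorem bhFewCollisions_reduction_anchor : CollisionMomentBound → ∀ (a₀ θ₀ : T3 → ℝ) (u₀ : T3 → V3), NiceProfiles a₀ θ₀ u₀ → ∃ σ₀ : ℝ, 0 < σ₀ ∧ ∀ σ : ℝ, 0 < σ → σ < σ₀ → ∀ (Φ : Flows σ) (t : ℝ), 0 < t → FewCollisionsOn σ a₀ θ₀ u₀ Φ t :=
  fun h a₀ θ₀ u₀ hnice => fewCollisionsOn_of_collisionMomentBound h a₀ θ₀ u₀ hnice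

end FewCollisions

end

end Summit.AtomisticToContinuum.HydrodynamicLimit.Theorems.BlockHDissipation
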